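import Mathlib
import Summits.Ventures.FusionMHD.Models.CerfonFreidbergIterLikeQHalfShearDefs
import HarnessLib

/-!
# Ventures/FusionMHD — Models/CerfonFreidbergIterLikeQHalfShearPanels14.lean: KERNEL CHECK of the shear-register certificates of panels 26, 27 (of 32)
# at `ψ_N = 1/2` of THE Cerfon–Freidberg ITER-like instance

HONEST FRAMING (LADDER-GRIDFUSION three columns; CF rung; successor step of «q′(ψ_N = 1/2) on the CF rung», F2-SCOPING v1.6 §10(c)).  One `decide +kernel`
(≈ 80 s): for each listed panel the obligation `CFIterLike.QHalfShear.ShearCert.ok` (`Models/CerfonFreidbergIterLikeQHalfShearDefs.lean`) — the Taylor-model run of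
`progQ = CFIterLike.QHalf.progA ++ blockQ` over ★ #117's parameter box is ACCEPTED and the kernel's panel-integral enclosure of the shear kernel `K·p` along the
approximant lies inside the claimed integers (read off a compiled `#eval` of the same functions, slack one unit of `2⁻⁶⁰`; float truth inside every panel).
MODELLED: analytic Cerfon–Freidberg family; nothing about a device or stability.  No `native_decide`.  Typer/prover: gridfusion-model-5 (g8), 2026-08-27.
Citations: Freidberg 2014 §6.3.5 (6.35) [Freidberg2014]; Mahboubi–Melquiond–Sibut-Pinote 2016 §3.2 Lemma 3 [MahboubiMelquiondSibutpinote2016].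
-/

namespace Summit.Ventures.FusionMHD.Models.CFIterLike.QHalfShear

/-- Shear-register certificate data of panels 26, 27. [instance data] -/
def shearCert14 : List ShearCert := [
  { j := 26, cand := [1082441316894905597952, -4573244956266420764672, 21662964832938389143552, -47965648640874253385728, 13433214324780927287296, 779326180904034818326528, -5245741710347348113096704, 22926655630538056757411840, -70632570368055580316139520, 142181442242395100560752640, 3203270518738002809305694208, -56580902814749737049598722048, -3463106934707528007076489986048],
    deg := 10, elog2 := 44, plo := 7600213358467053450, phi := 7600213683008354739 },
  { j := 27, cand := [959250614030703525888, -3355281914999583277056, 17420340632327624327168, -41219451437685439201280, 78641741302011334230016, 161119199317418745790464, -1829626687221566351081472, 9713523746278181401788416, -37246207860443652548460544, 113136241824943908015046656, 2206406304914952728919146496, -11597390560946137221436538880, -2631024527287013873666098200576],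
    deg := 10, elog2 := 44, plo := 6826119795015596642, phi := 6826120109766424557 }]

/-- **KERNEL CHECK** of the shear register on panels 26, 27. -/
theorem shearCert14_ok : CFIterLike.QHalfShear.shearCert14.all ShearCert.ok = true := by
  decide +kernel

end Summit.Ventures.FusionMHD.Models.CFIterLike.QHalfShear
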